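import Summits.ResolutionOfSingularities.ResolutionOfSingularities.Theorems.FrobeniusLadderFInjectiveMacaulayficationTauFloorP2d5CYChartIdent
import Summits.ResolutionOfSingularities.ResolutionOfSingularities.Theorems.FrobeniusLadderFInjectiveMacaulayficationTauFloorOneChartSymmetry
import HarnessLib

/-!
# (O-1′-S) The charts `D(ū)`, `D(t̄)`, `D(s̄)` of `Bl_τ(P2d5C)` by the `S₄`-symmetry `y ↔ u ↔ t ↔ s`: CM at every prime
# (crux `FInjectiveMacaulayfication` stmt-ResolutionOfSingularities-15315, chain w45a; res-L1-w45a-plan-1 g19 RULING R19.15 «(O-1′) → stub-1: D(ū)/D(t̄)/D(s̄) by the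
# S₄-symmetry»; seat res-L1-w45a-stub-1 g11; pattern = res-L1-w45a-stub-3's `TauFloorF5ChartSymmetry` over res-L1-w45a-stub-1's generic `TauFloorOneChartSymmetry` §1)

[OURS · L1 W4.5a] Support file (`--supports stmt-ResolutionOfSingularities-15315 --as helper`); def-free, unconditional, characteristic-free; replaces the role of
NO printed item; NOT a statement of the manuscript; AI-written (AI review is weaker than expert review).

`f = X₅² + X₀⁴X₅ + X₁³ + X₂³ + X₃³ + X₄³` is invariant under the transpositions `X₁ ↔ X_j`, `j ∈ {2, 3, 4}`; the induced automorphisms `σ̄` of `A₀ = k[X]/(f)` fix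
`τ = (x̄², ȳ, ū, t̄, s̄, z̄)` (as a set of generators) and send `ȳ` to `x̄_j`, hence induce `A₀[τ/ȳ] ≃+* A₀[τ/x̄_j]` (`TauFloorOneChartSymmetry.exists_blowupAlgebra_congr'`).
Transporting `TauFloorP2d5CYChartIdent.cmCl_localization_blowupAlgebra`: ★ `cmCl_localization_blowupAlgebra_of_swap` — CM at every prime of `A₀[τ/x̄_j]`,
`j ∈ {2, 3, 4}`. (Only the CM half is transported: the row needs ONE non-FULL point, which the chart `D(ȳ)` already supplies.) [folklore; cite: GortzWedhorn2020, (13.19)]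
-/

-- single-problem summit: the doubled namespace component is forced
set_option linter.dupNamespace false

noncomputable section

namespace Summit.ResolutionOfSingularities.ResolutionOfSingularities.Theorems.FInjectiveMacaulayfication.TauFloorP2d5CChartSymmetry

open MvPolynomial IsLocalRing Literature.AlgebraicGeometry.Resolution
open Summit.ResolutionOfSingularities.ResolutionOfSingularities.Theorems.FInjectiveMacaulayfication
open SliceableCentre

variable (k : Type) [Field k]

/-! ## §1 The automorphisms `X₁ ↔ X_j` (`j = 2, 3, 4`) of `A₀` -/

set_option maxHeartbeats 800000 in
-- three symmetric cases, each a generator bookkeeping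
/-- For `j ∈ {2, 3, 4}`: the transposition `X₁ ↔ X_j` fixes `f`, so induces `σ̄ : A₀ ≃+* A₀` with `σ̄ x̄ᵢ = x̄_{swap i}`; `σ̄` fixes `τ = (x̄², ȳ, ū, t̄, s̄, z̄)` and sends
`ȳ` to `x̄_j`. [plumbing] -/
theorem exists_swap_auto (f : MvPolynomial (Fin 6) k) (hf : f = X 5 ^ 2 + X 0 ^ 4 * X 5 + X 1 ^ 3 + X 2 ^ 3 + X 3 ^ 3 + X 4 ^ 3) (j : Fin 6) (hj : j = 2 ∨ j = 3 ∨ j = 4) :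
    ∃ σ : (MvPolynomial (Fin 6) k ⧸ Ideal.span {f}) ≃+* (MvPolynomial (Fin 6) k ⧸ Ideal.span {f}),
      (∀ i : Fin 6, σ (Ideal.Quotient.mk (Ideal.span {f}) (X i)) = Ideal.Quotient.mk (Ideal.span {f}) (X (Equiv.swap 1 j i))) ∧
      Ideal.map σ (Ideal.span {Ideal.Quotient.mk (Ideal.span {f}) (X 0) ^ 2, Ideal.Quotient.mk (Ideal.span {f}) (X 1),
          Ideal.Quotient.mk (Ideal.span {f}) (X 2), Ideal.Quotient.mk (Ideal.span {f}) (X 3), Ideal.Quotient.mk (Ideal.span {f}) (X 4), Ideal.Quotient.mk (Ideal.span {f}) (X 5)}) =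
        Ideal.span {Ideal.Quotient.mk (Ideal.span {f}) (X 0) ^ 2, Ideal.Quotient.mk (Ideal.span {f}) (X 1),
          Ideal.Quotient.mk (Ideal.span {f}) (X 2), Ideal.Quotient.mk (Ideal.span {f}) (X 3), Ideal.Quotient.mk (Ideal.span {f}) (X 4), Ideal.Quotient.mk (Ideal.span {f}) (X 5)} ∧
      σ (Ideal.Quotient.mk (Ideal.span {f}) (X 1)) = Ideal.Quotient.mk (Ideal.span {f}) (X j) := by
  set ρ : MvPolynomial (Fin 6) k ≃+* MvPolynomial (Fin 6) k := (renameEquiv k (Equiv.swap (1 : Fin 6) j)).toRingEquiv with hρ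
  have hρX : ∀ i : Fin 6, ρ (X i) = X (Equiv.swap 1 j i) := fun i => rename_X _ i
  have hρf : ρ f = f := by
    rw [hf]
    simp only [map_add, map_mul, map_pow, hρX]
    rcases hj with rfl | rfl | rfl
    · rw [show Equiv.swap (1 : Fin 6) 2 5 = 5 by decide, show Equiv.swap (1 : Fin 6) 2 0 = 0 by decide, Equiv.swap_apply_left,
        Equiv.swap_apply_right, show Equiv.swap (1 : Fin 6) 2 3 = 3 by decide, show Equiv.swap (1 : Fin 6) 2 4 = 4 by decide]
      ring
    · rw [show Equiv.swap (1 : Fin 6) 3 5 = 5 by decide, show Equiv.swap (1 : Fin 6) 3 0 = 0 by decide, Equiv.swap_apply_left,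
        Equiv.swap_apply_right, show Equiv.swap (1 : Fin 6) 3 2 = 2 by decide, show Equiv.swap (1 : Fin 6) 3 4 = 4 by decide]
      ring
    · rw [show Equiv.swap (1 : Fin 6) 4 5 = 5 by decide, show Equiv.swap (1 : Fin 6) 4 0 = 0 by decide, Equiv.swap_apply_left,
        Equiv.swap_apply_right, show Equiv.swap (1 : Fin 6) 4 2 = 2 by decide, show Equiv.swap (1 : Fin 6) 4 3 = 3 by decide]
      ring
  have hIJ : Ideal.span {f} = Ideal.map (ρ : MvPolynomial (Fin 6) k →+* MvPolynomial (Fin 6) k) (Ideal.span {f}) := by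
    rw [Ideal.map_span, Set.image_singleton]
    exact congrArg _ (congrArg _ hρf.symm)
  have himg : ∀ i : Fin 6, Ideal.quotientEquiv (Ideal.span {f}) (Ideal.span {f}) ρ hIJ (Ideal.Quotient.mk (Ideal.span {f}) (X i)) =
      Ideal.Quotient.mk (Ideal.span {f}) (X (Equiv.swap 1 j i)) := fun i => by rw [Ideal.quotientEquiv_mk, hρX]
  refine ⟨Ideal.quotientEquiv (Ideal.span {f}) (Ideal.span {f}) ρ hIJ, himg, ?_, ?_⟩
  · rw [Ideal.map_span]
    simp only [Set.image_insert_eq, Set.image_singleton, map_pow, himg]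
    rcases hj with rfl | rfl | rfl
    · rw [show Equiv.swap (1 : Fin 6) 2 5 = 5 by decide, show Equiv.swap (1 : Fin 6) 2 0 = 0 by decide, Equiv.swap_apply_left,
        Equiv.swap_apply_right, show Equiv.swap (1 : Fin 6) 2 3 = 3 by decide, show Equiv.swap (1 : Fin 6) 2 4 = 4 by decide]
      exact congrArg Ideal.span (by ext; simp only [Set.mem_insert_iff, Set.mem_singleton_iff]; tauto)
    · rw [show Equiv.swap (1 : Fin 6) 3 5 = 5 by decide, show Equiv.swap (1 : Fin 6) 3 0 = 0 by decide, Equiv.swap_apply_left,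
        Equiv.swap_apply_right, show Equiv.swap (1 : Fin 6) 3 2 = 2 by decide, show Equiv.swap (1 : Fin 6) 3 4 = 4 by decide]
      exact congrArg Ideal.span (by ext; simp only [Set.mem_insert_iff, Set.mem_singleton_iff]; tauto)
    · rw [show Equiv.swap (1 : Fin 6) 4 5 = 5 by decide, show Equiv.swap (1 : Fin 6) 4 0 = 0 by decide, Equiv.swap_apply_left,
        Equiv.swap_apply_right, show Equiv.swap (1 : Fin 6) 4 2 = 2 by decide, show Equiv.swap (1 : Fin 6) 4 3 = 3 by decide]
      exact congrArg Ideal.span (by ext; simp only [Set.mem_insert_iff, Set.mem_singleton_iff]; tauto)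
  · rw [himg, Equiv.swap_apply_left]

/-! ## §2 The charts `D(ū)`, `D(t̄)`, `D(s̄)` -/

/-- ★ **Charts `D(x̄_j)`, `j ∈ {2,3,4}` (= `D(ū)`, `D(t̄)`, `D(s̄)`): CM at every prime of `A₀[τ/x̄_j]`** (transport of
`TauFloorP2d5CYChartIdent.cmCl_localization_blowupAlgebra` along the symmetry `X₁ ↔ X_j`). [folklore] -/
theorem cmCl_localization_blowupAlgebra_of_swap (f : MvPolynomial (Fin 6) k) (hf : f = X 5 ^ 2 + X 0 ^ 4 * X 5 + X 1 ^ 3 + X 2 ^ 3 + X 3 ^ 3 + X 4 ^ 3)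
    (j : Fin 6) (hj : j = 2 ∨ j = 3 ∨ j = 4)
    (Q : Ideal (blowupAlgebra (Ideal.span {Ideal.Quotient.mk (Ideal.span {f}) (X 0) ^ 2, Ideal.Quotient.mk (Ideal.span {f}) (X 1),
      Ideal.Quotient.mk (Ideal.span {f}) (X 2), Ideal.Quotient.mk (Ideal.span {f}) (X 3), Ideal.Quotient.mk (Ideal.span {f}) (X 4), Ideal.Quotient.mk (Ideal.span {f}) (X 5)} :
        Ideal (MvPolynomial (Fin 6) k ⧸ Ideal.span {f})) (Ideal.Quotient.mk (Ideal.span {f}) (X j)))) [Q.IsPrime] :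
    CMCl (Localization.AtPrime Q) := by
  obtain ⟨σ, -, hτ, hy⟩ := exists_swap_auto k f hf j hj
  obtain ⟨E₀, -⟩ := TauFloorOneChartSymmetry.exists_blowupAlgebra_congr' σ _ _ hτ _ _ hy
  exact ReesChartFacts.transport_cmCl E₀ (fun P _ => TauFloorP2d5CYChartIdent.cmCl_localization_blowupAlgebra k f hf P) Q

end Summit.ResolutionOfSingularities.ResolutionOfSingularities.Theorems.FInjectiveMacaulayfication.TauFloorP2d5CChartSymmetry

end
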